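import Summits.QuantumFields.BalabanUV.T4Continuum.Support.AveragingDeficitBlockDensity
import Summits.QuantumFields.BalabanUV.T4Continuum.Support.BlockAverageDbarLinNorms
import Summits.QuantumFields.BalabanUV.T4Continuum.Support.BlockAverageLoopFlux
import HarnessLib

/-!
# AveragingDeficitBlockDensityFrame (T⁴ programme, node NE3, row NE3-R2, gen 6) — THE LINEARISED FRAMES SEE THE BLOCK DENSITY
# EXACTLY: `frameLin L U (S₀φ) (L•y) = ((L−1)/2L)·Σ_j Ad_{U(Γ_{(y,j)})} φ(y,j)`, and the frame part of `pushDir L U (S₀φ)` is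
# `−((L−1)/2L)·Ad_{V̄(c)⁻¹} Σ_j covFd (cavg L U) φ y κ j` up to `4·loopRad·Σ_j(‖φ(y,j)‖ + ‖φ(y+e_κ,j)‖)`
# (file 4 of (γ2), the gradient-bounded one-step lift — record `t4/T4-EST-NE3-R2.md` v0.6 §4)

HONEST FRAMING (cell `pub-balaban`, T4-DAG PAGE 1; unit `b2b-balaban-t4-ne3r2-p1` = owner of BINDER-OWNERS row NE3-R2, gen 6).
The cell's T4 target is the finite-torus continuum limit of the unit-scale averaged loop expectations — NOT infinite volume, NO
mass gap, NOT Clay, NOT summit progress.  WHY.  The lift `S = S₀ − spreadInverse ∘ (pushDir ∘ S₀ − Id)` of (γ2) needs the STRUCTURE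
of `pushDir L U (S₀φ)`; by leaf-10's split `pushDir = gaugeDir (cavg L U) (frameLin ∘ L•) + dbarLin` (`BlockAveragePushDirSplit`) its
gauge part is generated by the linearised block frames `frameLin L U Y y = Σ_{x∈B(y)} L^{−d} (δ_Y U)(Γ_{y,x})`.  THIS FILE computes them
EXACTLY for `Y = S₀φ = blockDensity L U φ` (file 2): the block density was transported along the very tree contours `Γ_{Ly,·}` the frames
read, so every tree bond in direction `j` contributes `L⁻¹·Ad_{U(Γ_{(y,j)})}φ(y,j)` and the contour `Γ_{Ly,Ly+r}` has `r_j` of them.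
All [folklore], 0 sorry: §1 the prefix property of the tree contours `Γ_{q,q+u+e_j} = Γ_{q,q+u} ∪ ⟨q+u, q+u+e_j⟩` for `u ≥ 0` with
vanishing coordinates below `j` (`treeWord_add_e`, via leaf-10's `BlockAverageLoopFlux.treeWord_upper_succ`); §2 the transport along a
tree segment `(δ_{S₀φ}U)([p, p+me_j]) = (m/L)·Ad_{U(Γ_{q,p})⁻¹U(Γ_{(y,j)})}φ(y,j)` (`dhol_seg_blockDensity_tree`) and along the whole contour
**`dhol_treeWord_blockDensity`**: `(δ_{S₀φ}U)(Γ_{Ly,Ly+r}) = Σ_j (r_j/L)·Ad_{U(Γ_{(y,j)})}φ(y,j)`; §3 **`frameLin_blockDensity`** (first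
moment `Σ_r L^{−d} r_j = (L−1)/2`, leaf-10's `sum_boxCoord`); §4 the frame part against the coarse covariant differences:
**`norm_gaugeDir_frameLin_add_le`**: `‖gaugeDir (cavg L U) Λ y κ + ((L−1)/2L)·Ad_{V̄(c)⁻¹} Σ_j covFd (cavg L U) φ y κ j‖ ≤
4·loopRad·Σ_j (‖φ(y,j)‖ + ‖φ(y+e_κ,j)‖)` (the `e^{X_c}` factors, file 2 §5).  NE3 ITSELF IS NOT PROVED; nothing of Bałaban's is
asserted (context: [Balaban1985Averaging] (42) p. 23, (110)–(112) p. 34; [Balaban1984PropagatorsI] (1.7) p. 18).  ABSOLUTE RULE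
kept: no printed sentence is a hypothesis.  PLACEMENT: `Summits/QuantumFields/BalabanUV/`; imports this row's
`AveragingDeficitBlockDensity` and leaf-10's `BlockAverageDbarLinNorms` ∕ `BlockAverageLoopFlux`; moves nothing.
-/

set_option autoImplicit false

open scoped BigOperators Matrix Matrix.Norms.L2Operator
open NormedSpace Finset

namespace Summit.QuantumFields.BalabanUV.T4Continuum.AveragingDeficitBlockDensityFrame

open Literature.MathematicalPhysics.QuantumFieldTheory.Balaban1983to89
open B7Prop1Explicit B7Prop2Explicit MatrixLog UnitaryModel
open T4AveragingDeficitWall hiding Site Plane Plaq Bond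
open T4AveragingDeficitNonAbelian (Ad_mul Ad_sub)
open AveragingDeficitTransport (dhol dhol_nil dhol_cons dstep dhol_append norm_Ad_of_unitary)
open AveragingDeficitNearIdentity (Ad_one norm_Ad_sub_le Ad_real_smul Ad_add Ad_sum)
open AveragingDeficitChartCalculus (cavg)
open AveragingDeficitCovGrad (covFd)
open SpreadLift (loopRad)
open SkeletonLattice (cdiv cmod cdiv_eq_of_repr)
open BlockAveragePushDirGauge (gaugeDir)
open BlockAveragePushDirSplit (frameLin)
open BlockAverageLoopFlux (upper upper_apply_of_le upper_apply_of_lt upper_of_le treeWord_upper_succ sum_boxCoord)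
open AveragingDeficitBlockDensity

noncomputable section

variable {d : ℕ} {n : Type*} [Fintype n] [DecidableEq n]

/-! ## §1 The prefix property of the tree contours -/

omit [Fintype n] [DecidableEq n] in
/-- A vector with vanishing coordinates below `j` is its own `upper j`. [folklore] -/
theorem upper_eq_self_of_zero_below {j : ℕ} (u : Site d) (h0 : ∀ i : Fin d, (i : ℕ) < j → u i = 0) : upper j u = u := by
  funext i
  by_cases h : j ≤ (i : ℕ)
  · exact upper_apply_of_le u h
  · rw [upper_apply_of_lt u (not_le.mp h), h0 i (not_le.mp h)]

omit [Fintype n] [DecidableEq n] in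
/-- **PREFIX PROPERTY**: `Γ_{q,q+u+e_j} = Γ_{q,q+u} ∪ ⟨q+u, q+u+e_j⟩` when `u ≥ 0` has vanishing coordinates below `j` (B5 (1.7): the
coordinates are changed in the order `d−1, …, 0`). [cite: Balaban1984PropagatorsI, (1.7) p.18] -/
theorem treeWord_add_e (u : Site d) (j : Fin d) (h0 : ∀ i : Fin d, (i : ℕ) < j → u i = 0) (hj : 0 ≤ u j) :
    treeWord (u + e j) = treeWord u ++ [(j, true)] := by
  have h0' : ∀ i : Fin d, (i : ℕ) < j → (u + e j) i = 0 := fun i hi => by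
    have hne : i ≠ j := fun h => by subst h; exact lt_irrefl _ hi
    rw [Pi.add_apply, e_apply, if_neg hne, add_zero, h0 i hi]
  have e1 : treeWord u = treeWord (upper ((j : ℕ) + 1) u) ++ seg j (u j) := by
    rw [← treeWord_upper_succ j u, upper_eq_self_of_zero_below u h0]
  have e2 : treeWord (u + e j) = treeWord (upper ((j : ℕ) + 1) (u + e j)) ++ seg j ((u + e j) j) := by
    rw [← treeWord_upper_succ j (u + e j), upper_eq_self_of_zero_below (u + e j) h0']
  have e3 : upper ((j : ℕ) + 1) (u + e j) = upper ((j : ℕ) + 1) u := by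
    funext i
    by_cases h : (j : ℕ) + 1 ≤ (i : ℕ)
    · have hne : i ≠ j := fun h' => by subst h'; omega
      rw [upper_apply_of_le _ h, upper_apply_of_le _ h, Pi.add_apply, e_apply, if_neg hne, add_zero]
    · rw [upper_apply_of_lt _ (not_le.mp h), upper_apply_of_lt _ (not_le.mp h)]
  obtain ⟨k, hk⟩ := Int.eq_ofNat_of_zero_le hj
  have e4 : seg j ((u + e j) j) = seg j (u j) ++ [(j, true)] := by
    rw [Pi.add_apply, e_apply, if_pos rfl, hk, show (k : ℤ) + 1 = ((k + 1 : ℕ) : ℤ) by push_cast; ring, seg_natCast,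
      seg_natCast, List.replicate_succ']
  rw [e2, e3, e4, e1, List.append_assoc]

/-! ## §2 The linearised transport of the block density along tree segments and tree contours -/

/-- The group identity behind the telescoping: `U·((B·U)⁻¹·S) = B⁻¹·S`. [folklore] -/
theorem units_tel (Uu B S : (Matrix n n ℂ)ˣ) : Uu * ((B * Uu)⁻¹ * S) = B⁻¹ * S := by
  rw [mul_inv_rev, ← mul_assoc, ← mul_assoc, mul_inv_cancel, one_mul]

/-- **ALONG A TREE SEGMENT**: from a tree point `p = Ly + u` (`u ≥ 0`, coordinates below `j` vanishing) the `m` bonds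
`[p, p + me_j]` inside the block carry `(δ_{S₀φ}U)([p,p+me_j]) = (m/L)·Ad_{U(Γ_{Ly,p})⁻¹ U(Γ_{(y,j)})} φ(y,j)` EXACTLY. [folklore] -/
theorem dhol_seg_blockDensity_tree {L : ℕ} (hL : 1 ≤ L) (U : Site d → Fin d → (Matrix n n ℂ)ˣ)
    (φ : Site d → Fin d → Matrix n n ℂ) (y : Site d) (j : Fin d) :
    ∀ (m : ℕ) (u : Site d), (∀ i : Fin d, (i : ℕ) < j → u i = 0) → (∀ i, 0 ≤ u i) → (∀ i, i ≠ j → u i < L) →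
      u j + m ≤ L →
      dhol U (blockDensity L U φ) ((L : ℤ) • y + u) (seg j m)
        = ((m : ℝ) / L) • Ad ((btree L U y ((L : ℤ) • y + u))⁻¹ * bseg L U y j) (φ y j)
  | 0, u, _, _, _, _ => by simp
  | m + 1, u, h0, hnn, hlt, hm => by
    -- the first bond `⟨p, p + e_j⟩`, `p = Ly + u`, lies in the block of `y`
    have hujL : u j < L := by push_cast at hm; omega
    have hcd : cdiv L ((L : ℤ) • y + u) = y := cdiv_eq_of_repr rfl hnn fun i => by
      by_cases h : i = j
      · subst h; exact hujL
      · exact hlt i h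
    -- the tree transport to `p + e_j` factors through `p`
    have htree : btree L U y ((L : ℤ) • y + u + e j) = btree L U y ((L : ℤ) • y + u) * U ((L : ℤ) • y + u) j := by
      unfold btree
      rw [show (L : ℤ) • y + u + e j - (L : ℤ) • y = u + e j by abel, show (L : ℤ) • y + u - (L : ℤ) • y = u by abel,
        treeWord_add_e u j h0 (hnn j), hol_append, disp_treeWord, hol_cons, hol_nil, mul_one, stepHol_true]
    -- induction hypothesis at `u + e_j`
    have h0' : ∀ i : Fin d, (i : ℕ) < j → (u + e j) i = 0 := fun i hi => by
      have hne : i ≠ j := fun h => by subst h; exact lt_irrefl _ hi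
      rw [Pi.add_apply, e_apply, if_neg hne, add_zero, h0 i hi]
    have hnn' : ∀ i, 0 ≤ (u + e j) i := fun i => by
      rw [Pi.add_apply, e_apply]; split_ifs <;> linarith [hnn i]
    have hlt' : ∀ i, i ≠ j → (u + e j) i < L := fun i hi => by
      rw [Pi.add_apply, e_apply, if_neg hi, add_zero]; exact hlt i hi
    have hm' : (u + e j) j + m ≤ L := by
      rw [Pi.add_apply, e_apply, if_pos rfl]; push_cast at hm ⊢; omega
    have ih := dhol_seg_blockDensity_tree hL U φ y j m (u + e j) h0' hnn' hlt' hm'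
    rw [show (L : ℤ) • y + (u + e j) = (L : ℤ) • y + u + e j by abel] at ih
    -- unfold one letter
    rw [show ((m + 1 : ℕ) : ℤ) = (m : ℤ) + 1 by push_cast; ring] 
    rw [show seg j ((m : ℤ) + 1) = (j, true) :: seg j (m : ℤ) by
      rw [show (m : ℤ) + 1 = ((m + 1 : ℕ) : ℤ) by push_cast; ring, seg_natCast, seg_natCast, List.replicate_succ]]
    rw [dhol_cons, Letter.vec_true, stepHol_true, AveragingDeficitTransport.dstep_true, ih, blockDensity_apply, hcd, htree]
    simp only [Ad_real_smul, ← Ad_mul, units_tel]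
    rw [← add_smul]
    congr 1
    have hL0 : (L : ℝ) ≠ 0 := by exact_mod_cast (by omega : L ≠ 0)
    field_simp
    push_cast
    ring

/-- The contour up to the directions `≥ m`: `(δ_{S₀φ}U)(Γ_{Ly, Ly + upper m r}) = Σ_{j ≥ m} (r_j/L)·Ad_{U(Γ_{(y,j)})}φ(y,j)`. [folklore] -/
theorem dhol_treeWord_upper_blockDensity {L : ℕ} (hL : 1 ≤ L) (U : Site d → Fin d → (Matrix n n ℂ)ˣ)
    (φ : Site d → Fin d → Matrix n n ℂ) (y : Site d) (r : Fin d → Fin L) :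
    ∀ (k m : ℕ), m + k = d →
      dhol U (blockDensity L U φ) ((L : ℤ) • y) (treeWord (upper m (boxVec L r)))
        = ∑ j : Fin d, if m ≤ (j : ℕ) then ((((r j : ℕ) : ℝ)) / L) • Ad (bseg L U y j) (φ y j) else 0
  | 0, m, hmk => by
    rw [upper_of_le (by omega) (boxVec L r), treeWord_zero, dhol_nil]
    symm
    exact Finset.sum_eq_zero fun j _ => if_neg (by have := j.isLt; omega)
  | k + 1, m, hmk => by
    have hmd : m < d := by omega
    set mF : Fin d := ⟨m, hmd⟩ with hmF
    have ih := dhol_treeWord_upper_blockDensity hL U φ y r k (m + 1) (by omega)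
    -- split the contour: directions `≥ m+1`, then the segment in direction `m`
    have hsplit : treeWord (upper m (boxVec L r)) = treeWord (upper (m + 1) (boxVec L r)) ++ seg mF (boxVec L r mF) :=
      treeWord_upper_succ mF (boxVec L r)
    rw [hsplit, dhol_append, disp_treeWord, ih]
    -- the segment term, by §2 with `u = upper (m+1) r`
    have hseg := dhol_seg_blockDensity_tree hL U φ y mF (r mF : ℕ) (upper (m + 1) (boxVec L r))
      (fun i hi => upper_apply_of_lt _ (by simp only [hmF] at hi; omega))
      (fun i => by
        by_cases h : m + 1 ≤ (i : ℕ)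
        · rw [upper_apply_of_le _ h]; simp [boxVec]
        · rw [upper_apply_of_lt _ (not_le.mp h)])
      (fun i _ => by
        by_cases h : m + 1 ≤ (i : ℕ)
        · rw [upper_apply_of_le _ h]; simp only [boxVec]; exact_mod_cast (r i).isLt
        · rw [upper_apply_of_lt _ (not_le.mp h)]; exact_mod_cast hL)
      (by rw [upper_apply_of_lt _ (by simp only [hmF]; omega)]; simp only [zero_add]; exact_mod_cast (r mF).isLt.le)
    have hbv : boxVec L r mF = ((r mF : ℕ) : ℤ) := rfl
    rw [hbv, hseg]
    -- the transport of the prefix cancels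
    have hbt : hol U ((L : ℤ) • y) (treeWord (upper (m + 1) (boxVec L r)))
        = btree L U y ((L : ℤ) • y + upper (m + 1) (boxVec L r)) := by
      unfold btree; rw [add_sub_cancel_left]
    rw [hbt, Ad_real_smul, ← Ad_mul, mul_inv_cancel_left]
    -- bookkeeping of the indicator sums
    have hpt : ∀ j : Fin d, (if m ≤ (j : ℕ) then ((((r j : ℕ) : ℝ)) / L) • Ad (bseg L U y j) (φ y j) else 0)
        = (if m + 1 ≤ (j : ℕ) then ((((r j : ℕ) : ℝ)) / L) • Ad (bseg L U y j) (φ y j) else 0)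
          + (if j = mF then ((((r j : ℕ) : ℝ)) / L) • Ad (bseg L U y j) (φ y j) else 0) := by
      intro j
      by_cases h1 : j = mF
      · subst h1
        rw [if_pos (show m ≤ (mF : ℕ) by simp only [hmF]; exact le_rfl),
          if_neg (show ¬ (m + 1 ≤ (mF : ℕ)) by simp only [hmF]; omega), if_pos rfl, zero_add]
      · have hne : (j : ℕ) ≠ m := fun h => h1 (Fin.ext h)
        by_cases h2 : m + 1 ≤ (j : ℕ)
        · rw [if_pos (by omega), if_pos h2, if_neg h1, add_zero]
        · rw [if_neg (by omega), if_neg h2, if_neg h1, add_zero]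
    rw [Finset.sum_congr rfl fun j _ => hpt j, Finset.sum_add_distrib, Finset.sum_ite_eq' Finset.univ mF, if_pos (Finset.mem_univ _)]

/-- **ALONG THE WHOLE TREE CONTOUR**: `(δ_{S₀φ}U)(Γ_{Ly,Ly+r}) = Σ_j (r_j/L)·Ad_{U(Γ_{(y,j)})} φ(y,j)` EXACTLY. [folklore] -/
theorem dhol_treeWord_blockDensity {L : ℕ} (hL : 1 ≤ L) (U : Site d → Fin d → (Matrix n n ℂ)ˣ)
    (φ : Site d → Fin d → Matrix n n ℂ) (y : Site d) (r : Fin d → Fin L) :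
    dhol U (blockDensity L U φ) ((L : ℤ) • y) (treeWord (boxVec L r))
      = ∑ j : Fin d, ((((r j : ℕ) : ℝ)) / L) • Ad (bseg L U y j) (φ y j) := by
  have h := dhol_treeWord_upper_blockDensity hL U φ y r d 0 (zero_add d)
  rw [BlockAverageLoopFlux.upper_zero] at h
  rw [h]
  exact Finset.sum_congr rfl fun j _ => if_pos (Nat.zero_le _)

/-! ## §3 The linearised frames of the block density -/

/-- **THE FRAMES SEE THE BLOCK DENSITY EXACTLY**: `frameLin L U (S₀φ) (L•y) = ((L−1)/2L)·Σ_j Ad_{U(Γ_{(y,j)})} φ(y,j)`.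
[cite: Balaban1985Averaging, (110)-(112) p.34] -/
theorem frameLin_blockDensity {L : ℕ} (hL : 1 ≤ L) (U : Site d → Fin d → (Matrix n n ℂ)ˣ)
    (φ : Site d → Fin d → Matrix n n ℂ) (y : Site d) :
    frameLin L U (blockDensity L U φ) ((L : ℤ) • y)
      = (((L : ℝ) - 1) / (2 * L)) • ∑ j : Fin d, Ad (bseg L U y j) (φ y j) := by
  unfold frameLin
  simp only [dhol_treeWord_blockDensity hL, Finset.smul_sum, smul_smul]
  rw [Finset.sum_comm]
  refine Finset.sum_congr rfl fun j _ => ?_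
  rw [← Finset.sum_smul]
  congr 1
  have hL0 : (L : ℝ) ≠ 0 := by exact_mod_cast (by omega : L ≠ 0)
  have h := sum_boxCoord (d := d) L j
  calc ∑ r : Fin d → Fin L, ((L : ℝ) ^ d)⁻¹ * ((((r j : ℕ) : ℝ)) / L)
      = ((L : ℝ) ^ d)⁻¹ / L * ∑ r : Fin d → Fin L, (((r j : ℕ) : ℝ)) := by
        rw [Finset.mul_sum]; exact Finset.sum_congr rfl fun r _ => by ring
    _ = ((L : ℝ) - 1) / (2 * L) := by rw [h]; field_simp

/-! ## §4 The frame part of `pushDir L U (S₀φ)` against the coarse covariant differences -/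

section Small

variable [Nonempty n] {L : ℕ} (hL : 1 ≤ L) {U : Site d → Fin d → (Matrix n n ℂ)ˣ} (hU : IsUnitaryCfg U) {a : ℝ} (ha : 0 ≤ a)
  (h512 : 512 * (d + 1) * (d + 4) * (L : ℝ) ^ 2 * a ≤ 1) (hUa : SmallField U a)

include hL in
omit [Nonempty n] in
/-- THE FRAME PART AS A SUM: `gaugeDir (cavg L U) Λ y κ + ((L−1)/2L)·Ad_{V̄(c)⁻¹} Σ_j covFd (cavg L U) φ y κ j
= ((L−1)/2L)·Σ_j [Ad_{V̄(c)⁻¹}(Ad_{U(Γ_{(y,j)})}φ(y,j) − Ad_{V̄(y,j)}φ(y,j)) + (Ad_{V̄(y+e_κ,j)}φ(y+e_κ,j) − Ad_{U(Γ_{(y+e_κ,j)})}φ(y+e_κ,j))]`.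
[folklore] -/
theorem gaugeDir_frameLin_blockDensity_add (φ : Site d → Fin d → Matrix n n ℂ) (y : Site d) (κ : Fin d) :
    gaugeDir (cavg L U) (fun z => frameLin L U (blockDensity L U φ) ((L : ℤ) • z)) y κ
        + (((L : ℝ) - 1) / (2 * L)) • Ad (cavg L U y κ)⁻¹ (∑ j : Fin d, covFd (cavg L U) φ y κ j)
      = (((L : ℝ) - 1) / (2 * L)) • ∑ j : Fin d,
          ((Ad (cavg L U y κ)⁻¹ (Ad (bseg L U y j) (φ y j)) - Ad (cavg L U y κ)⁻¹ (Ad (cavg L U y j) (φ y j)))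
            + (Ad (cavg L U (y + e κ) j) (φ (y + e κ) j) - Ad (bseg L U (y + e κ) j) (φ (y + e κ) j))) := by
  simp only [gaugeDir, frameLin_blockDensity hL, covFd, Ad_real_smul, Ad_sum, Ad_sub, ← Ad_mul, inv_mul_cancel_left,
    ← smul_sub, ← smul_add, ← Finset.sum_sub_distrib, ← Finset.sum_add_distrib]
  congr 1
  exact Finset.sum_congr rfl fun j _ => by abel

include hL hU ha h512 hUa in
/-- **THE FRAME PART IS `−((L−1)/2L)·Ad_{V̄(c)⁻¹} Σ_j covFd (cavg L U) φ y κ j` UP TO `4·loopRad·Σ_j(‖φ(y,j)‖ + ‖φ(y+e_κ,j)‖)`**.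
[folklore] -/
theorem norm_gaugeDir_frameLin_add_le (φ : Site d → Fin d → Matrix n n ℂ) (y : Site d) (κ : Fin d) :
    ‖gaugeDir (cavg L U) (fun z => frameLin L U (blockDensity L U φ) ((L : ℤ) • z)) y κ
        + (((L : ℝ) - 1) / (2 * L)) • Ad (cavg L U y κ)⁻¹ (∑ j : Fin d, covFd (cavg L U) φ y κ j)‖
      ≤ 4 * loopRad d L a * ∑ j : Fin d, (‖φ y j‖ + ‖φ (y + e κ) j‖) := by
  have hUc : ∀ z μ, cavg L U z μ ∈ unitaryUnits (Matrix n n ℂ) := fun z μ => cavg_mem hL hU ha h512 hUa z μ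
  have hlr0 : 0 ≤ loopRad d L a := by unfold SpreadLift.loopRad; positivity
  have hc0 : 0 ≤ ((L : ℝ) - 1) / (2 * L) := by
    have : (1 : ℝ) ≤ L := by exact_mod_cast hL
    exact div_nonneg (by linarith) (by positivity)
  have hc1 : ((L : ℝ) - 1) / (2 * L) ≤ 1 / 2 := by
    have hL' : (0 : ℝ) < L := by exact_mod_cast (by omega : 0 < L)
    rw [div_le_div_iff₀ (by positivity) (by norm_num)]
    linarith
  rw [gaugeDir_frameLin_blockDensity_add hL φ y κ, norm_smul, Real.norm_of_nonneg hc0]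
  -- termwise
  have hterm : ∀ j : Fin d,
      ‖(Ad (cavg L U y κ)⁻¹ (Ad (bseg L U y j) (φ y j)) - Ad (cavg L U y κ)⁻¹ (Ad (cavg L U y j) (φ y j)))
          + (Ad (cavg L U (y + e κ) j) (φ (y + e κ) j) - Ad (bseg L U (y + e κ) j) (φ (y + e κ) j))‖
        ≤ 2 * (4 * loopRad d L a) * ‖φ y j‖ + 2 * (4 * loopRad d L a) * ‖φ (y + e κ) j‖ := by
    intro j
    refine (norm_add_le _ _).trans (add_le_add ?_ ?_)
    · rw [← Ad_sub, norm_Ad_of_unitary ((unitaryUnits _).inv_mem (hUc y κ))]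
      exact norm_Ad_sub_Ad_le_of_le (bseg_mem hU L y j) (hUc y j) _ (norm_cavg_inv_bseg_sub_one_le hL hU ha h512 hUa y j)
    · exact norm_Ad_sub_Ad_le_of_le (hUc _ j) (bseg_mem hU L _ j) _ (norm_bseg_inv_cavg_sub_one_le hL hU ha h512 hUa _ j)
  have hsum := (norm_sum_le _ _).trans (Finset.sum_le_sum fun j (_ : j ∈ Finset.univ) => hterm j)
  have hS0 : 0 ≤ ∑ j : Fin d, (‖φ y j‖ + ‖φ (y + e κ) j‖) := Finset.sum_nonneg fun j _ => by positivity
  calc ((L : ℝ) - 1) / (2 * L) * ‖∑ j : Fin d, ((Ad (cavg L U y κ)⁻¹ (Ad (bseg L U y j) (φ y j))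
            - Ad (cavg L U y κ)⁻¹ (Ad (cavg L U y j) (φ y j)))
          + (Ad (cavg L U (y + e κ) j) (φ (y + e κ) j) - Ad (bseg L U (y + e κ) j) (φ (y + e κ) j)))‖
      ≤ (1 / 2) * ∑ j : Fin d, (2 * (4 * loopRad d L a) * ‖φ y j‖ + 2 * (4 * loopRad d L a) * ‖φ (y + e κ) j‖) :=
        mul_le_mul hc1 hsum (norm_nonneg _) (by norm_num)
    _ = 4 * loopRad d L a * ∑ j : Fin d, (‖φ y j‖ + ‖φ (y + e κ) j‖) := by
        rw [Finset.mul_sum, Finset.mul_sum]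
        exact Finset.sum_congr rfl fun j _ => by ring

end Small

end

end Summit.QuantumFields.BalabanUV.T4Continuum.AveragingDeficitBlockDensityFrame
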